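import Summits.Langlands.Langlands.Theses.MonodromyRankLadder
import Literature.NumberTheory.GaloisRepresentations.WeilDeligneRepFrobSemisimpleProofs
import HarnessLib

/-!
# `MonodromyRankLadder.FrobSemisimplificationGeneric` — proved outright
Item `stmt-Langlands-27784` (support, rank 9; the binder `hG` of the deciding theorem of route
`MonodromyRankLadder`): for a Weil–Deligne representation `W = (ρ, N)` of `W_F` on a
finite-dimensional space `V` over a field `C` of characteristic zero and its
Frobenius-semisimplification `W' = (ρ^{ss}, N)`, the GENERICITY predicate
  `Gen(ρ, N)`: every `f ∈ End V` with `f ρ(w) = q ^ {deg w} ρ(w) f` for all `w` and `f N = N f` is `0`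
holds for `W` iff it holds for `W'`.
## Proof
Deligne's construction (Antwerp II, 8.5; tree `WeilDeligneRep.exists_isFrobSemisimplificationOf`,
re-run here as `FrobSSGeneric.exists_unipotent` so as to EXPORT the unipotent `u`): there is a unit
`u` of `End V`, unipotent, commuting with `ρ(W_F)` and with `N`, such that
`ρ^{ss}(w) = ρ(w) u ^ {-deg w}`; by uniqueness of the Frobenius-semisimplification
(`IsFrobSemisimplificationOf.eq_of_eq`) the given `W'` is this one.
* `Gen(ρ^{ss}, N) → Gen(ρ, N)`: a twisted intertwiner `f` of `ρ(w) = ρ^{ss}(w) + n_w`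
  (Jordan–Chevalley, `n_w` nilpotent commuting with the semisimple `ρ^{ss}(w)`) is a twisted
  intertwiner of the semisimple part (`FrobSemisimple.mul_eq_smul_mul_of_jordanChevalley`).
* `Gen(ρ, N) → Gen(ρ^{ss}, N)`: let `H` be the space of twisted intertwiners of `(ρ^{ss}, N)` and
  `Z = Ad(u) - 1` on `End V`; `Z` is nilpotent (`u` unipotent), preserves `H` (`u` commutes with
  `ρ^{ss}` and `N`), and `H ∩ ker Z ⊆ {twisted intertwiners of (ρ, N)} = 0` (an `f ∈ H` commuting
  with `u` commutes past `u ^ {deg w}`).  A nilpotent operator on `H` with an injective restriction…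
  has `H = 0`: induction on `k` with `Z ^ k f = 0`.
Pure linear algebra over the tree's Weil–Deligne API; no Literature fact is consumed (the two
`IsFrobPow` facts used by the construction are the tree's discharged `mul_holds`/`unique_holds`).
lens-6 g28 node twin, 2026-08-31.
-/
set_option linter.dupNamespace false
namespace Summit.Langlands.Langlands.Theorems
namespace FrobSSGeneric
open Literature.NumberTheory.GaloisRepresentations
open Literature.NumberTheory.GaloisRepresentations.WeilGroup
open Literature.NumberTheory.GaloisRepresentations.IsNonarchimedeanLocalField
/-- Deligne's construction of the Frobenius-semisimplification WITH the unipotent twist exported: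
`u` unipotent, commuting with `ρ(W_F)` and `N`, and `ρ'(w) = ρ(w) u ^ (-deg w)`.  The proof is the
tree's `WeilDeligneRep.exists_isFrobSemisimplificationOf` (WeilDeligneRepFrobSemisimpleProofs),
re-run verbatim with the witness `u` kept in the conclusion. -/
theorem exists_unipotent
    {F : Type*} [Field F] [ValuativeRel F] [TopologicalSpace F] [IsNonarchimedeanLocalField F]
    {C : Type*} [Field C] [CharZero C] [PerfectField C]
    {V : Type*} [AddCommGroup V] [Module C V] [FiniteDimensional C V]
    (r : WeilDeligneRep F C V) :
    ∃ (u : (Module.End C V)ˣ) (r' : WeilDeligneRep F C V),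
      r'.IsFrobSemisimplificationOf r ∧ IsNilpotent ((u : Module.End C V) - 1) ∧
      (∀ w, Commute (u : Module.End C V) (r.ρ w)) ∧ Commute (u : Module.End C V) r.N ∧
      ∀ w, r'.ρ w = r.ρ w * ((u ^ (-deg w) : (Module.End C V)ˣ) : Module.End C V) := by
  have hmul : IsFrobPow.mul (F := F) := IsFrobPow.mul_holds
  have huniq : IsFrobPow.unique (F := F) := IsFrobPow.unique_holds
  obtain ⟨Φ, hΦ⟩ := WeilDeligneRep.exists_deg_eq_one (F := F)
  obtain ⟨m, hm, hcomm⟩ := r.exists_commute_pow_of_mem_inertia Φ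
  -- `T = ρ(Φ)` as a unit and its Jordan–Chevalley decomposition `ρ(Φ) = n + s`
  set T : (Module.End C V)ˣ := r.ρ.toHomUnits Φ with eT
  have hT : (T : Module.End C V) = r.ρ Φ := rfl
  have hT' : ((T⁻¹ : (Module.End C V)ˣ) : Module.End C V) = r.ρ Φ⁻¹ := by
    rw [eT, ← map_inv]; rfl
  obtain ⟨n, hn, s, hs, hnil, hss, hTns⟩ :=
    Module.End.exists_isNilpotent_isSemisimple (f := (r.ρ Φ : Module.End C V))
  have hnT : Commute n (r.ρ Φ) := (Algebra.commute_of_mem_adjoin_self hn).symm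
  have hsT : Commute s (r.ρ Φ) := (Algebra.commute_of_mem_adjoin_self hs).symm
  have hsn : Commute s n := Algebra.commute_of_mem_adjoin_singleton_of_commute hn hsT
  -- `s` is a unit; the unipotent part `u = s⁻¹ ρ(Φ)`
  have hsu : IsUnit s := by
    have e : s = -n + r.ρ Φ := by rw [hTns]; abel
    rw [e]
    exact hnil.neg.isUnit_add_right_of_commute T.isUnit hnT.neg_left
  set sU : (Module.End C V)ˣ := hsu.unit with esU
  have hsU : (sU : Module.End C V) = s := hsu.unit_spec
  have hsis : ((sU⁻¹ : (Module.End C V)ˣ) : Module.End C V) * s = 1 := by rw [← hsU, Units.inv_mul]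
  have hssi : s * ((sU⁻¹ : (Module.End C V)ˣ) : Module.End C V) = 1 := by rw [← hsU, Units.mul_inv]
  set u : (Module.End C V)ˣ := sU⁻¹ * T with eu
  have hu : (u : Module.End C V) = ((sU⁻¹ : (Module.End C V)ˣ) : Module.End C V) * r.ρ Φ := rfl
  have csT : Commute sU T := Commute.units_of_val (by rw [hsU, hT]; exact hsT)
  have hTsu : T = sU * u := by rw [eu, mul_inv_cancel_left]
  have hsTu : sU = T * u⁻¹ := by rw [hTsu, mul_inv_cancel_right]
  have csu : Commute sU u := Commute.mul_right (Commute.refl sU).inv_right csT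
  have cTu : Commute T u := by rw [hTsu]; exact Commute.mul_left csu (Commute.refl u)
  have hu1 : (u : Module.End C V) - 1 = ((sU⁻¹ : (Module.End C V)ˣ) : Module.End C V) * n := by
    rw [hu, hTns, mul_add, hsis]
    abel
  have hunil : IsNilpotent ((u : Module.End C V) - 1) := by
    rw [hu1]
    have c1 : Commute (sU : Module.End C V) n := by rw [hsU]; exact hsn
    exact c1.units_inv_left.isNilpotent_mul_left hnil
  -- `T ^ m` is central in `ρ(W_F)`, hence in `B = C[ρ(W_F)]`
  have hTm : ∀ w, Commute (T ^ m) (r.ρ.toHomUnits w) := fun w => by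
    have hw : w = Φ ^ (deg w) * (Φ ^ (-deg w) * w) := by rw [zpow_neg, mul_inv_cancel_left]
    rw [hw, map_mul, map_zpow]
    exact Commute.mul_right (((Commute.refl T).pow_left m).zpow_right (deg w))
      (hcomm _ (WeilDeligneRep.zpow_neg_deg_mul_mem_inertia hΦ w))
  set B : Subalgebra C (Module.End C V) := Algebra.adjoin C (Set.range r.ρ) with eB
  have hTmB : ∀ X ∈ B, Commute (((T ^ m : (Module.End C V)ˣ)) : Module.End C V) X :=
    fun X hX => Algebra.commute_of_mem_adjoin_of_forall_mem_commute hX fun b hb => by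
      obtain ⟨w, rfl⟩ := hb
      exact (hTm w).units_val
  -- `u` commutes with `B`
  haveI : FiniteDimensional C B := FiniteDimensional.finiteDimensional_submodule B.toSubmodule
  have hρB : ∀ w, r.ρ w ∈ B := fun w => Algebra.subset_adjoin ⟨w, rfl⟩
  have hadj : Algebra.adjoin C {r.ρ Φ} ≤ B :=
    Algebra.adjoin_mono (Set.singleton_subset_iff.mpr ⟨Φ, rfl⟩)
  have huB : ∀ X ∈ B, (u : Module.End C V) * X = X * u := by
    intro X hX
    set t : B := ⟨r.ρ Φ, hρB Φ⟩ with et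
    set t' : B := ⟨r.ρ Φ⁻¹, hρB Φ⁻¹⟩ with et'
    set sB : B := ⟨s, hadj hs⟩ with esB
    set nB : B := ⟨n, hadj hn⟩ with enB
    have ht : t * t' = 1 := Subtype.ext (by simp [et, et', ← map_mul])
    have ht' : t' * t = 1 := Subtype.ext (by simp [et, et', ← map_mul])
    have hts : t = nB + sB := Subtype.ext hTns
    have hsB : Squarefree (minpoly C sB) := by
      have e : minpoly C sB = minpoly C s := by
        rw [← minpoly.algHom_eq B.val Subtype.val_injective sB]
        rfl
      rw [e]
      exact hss.minpoly_squarefree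
    have hnB : IsNilpotent nB := by
      obtain ⟨k, hk⟩ := hnil
      exact ⟨k, Subtype.ext (by simp [enB, hk])⟩
    have hsBnB : Commute sB nB := Subtype.ext hsn.eq
    have hcentral : ∀ y : B, t ^ m * y = y * t ^ m := fun y =>
      Subtype.ext (by simpa [et, Units.val_pow_eq_pow_val, hT] using (hTmB y y.2).eq)
    have key := FrobSemisimple.mul_eq_conj_mul_of_pow_central ht ht' hts hsB hnB hsBnB hm hcentral
      ⟨X, hX⟩
    have key' : s * X = r.ρ Φ * (X * s) * r.ρ Φ⁻¹ := by
      simpa [et, et', esB] using congrArg Subtype.val key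
    rw [hu]
    refine FrobSemisimple.inv_mul_comm_of_conj hsis hssi ?_ ?_ key'
    · rw [← map_mul, inv_mul_cancel, map_one]
    · have c1 : Commute (r.ρ Φ) (sU : Module.End C V) := by rw [hsU]; exact hsT.symm
      exact (c1.units_inv_right).eq
  have huρ : ∀ w, Commute (u : Module.End C V) (r.ρ w) := fun w => huB _ (hρB w)
  -- `u` commutes with `N`
  have hq : ∀ w, r.ρ w * r.N = ((residueFieldCard F : C) ^ deg w) • (r.N * r.ρ w) := fun w => by
    have h := r.conj_N w
    simpa only [Module.End.mul_eq_comp] using h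
  have hsN : s * r.N = ((residueFieldCard F : C) ^ deg Φ) • (r.N * s) :=
    FrobSemisimple.mul_eq_smul_mul_of_jordanChevalley hTns hss hnil hsn (hq Φ)
  have huN : Commute (u : Module.End C V) r.N := by
    rw [Commute, SemiconjBy, hu]
    exact FrobSemisimple.inv_mul_comm_of_smul hsis hssi (hq Φ) hsN
  -- the Frobenius-semisimplification `ρ'(w) = ρ(w) u ^ (-deg w)`
  have hρ'mul : ∀ w w' : WeilGroup F,
      r.ρ (w * w') * ((u ^ (-deg (w * w')) : (Module.End C V)ˣ) : Module.End C V) =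
        r.ρ w * ((u ^ (-deg w) : (Module.End C V)ˣ) : Module.End C V) *
          (r.ρ w' * ((u ^ (-deg w') : (Module.End C V)ˣ) : Module.End C V)) := by
    intro w w'
    have hc : Commute ((u ^ (-deg w) : (Module.End C V)ˣ) : Module.End C V) (r.ρ w') :=
      (huρ w').units_zpow_left (-deg w)
    rw [map_mul, deg_mul hmul huniq, neg_add, zpow_add, Units.val_mul]
    calc r.ρ w * r.ρ w' * (((u ^ (-deg w) : (Module.End C V)ˣ) : Module.End C V) *
          ((u ^ (-deg w') : (Module.End C V)ˣ) : Module.End C V))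
        = r.ρ w * ((r.ρ w' * ((u ^ (-deg w) : (Module.End C V)ˣ) : Module.End C V)) *
          ((u ^ (-deg w') : (Module.End C V)ˣ) : Module.End C V)) := by simp only [mul_assoc]
      _ = r.ρ w * ((((u ^ (-deg w) : (Module.End C V)ˣ) : Module.End C V) * r.ρ w') *
          ((u ^ (-deg w') : (Module.End C V)ˣ) : Module.End C V)) := by rw [hc.eq]
      _ = r.ρ w * ((u ^ (-deg w) : (Module.End C V)ˣ) : Module.End C V) *
          (r.ρ w' * ((u ^ (-deg w') : (Module.End C V)ˣ) : Module.End C V)) := by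
          simp only [mul_assoc]
  set ρ' : Representation C (WeilGroup F) V :=
    { toFun := fun w => r.ρ w * ((u ^ (-deg w) : (Module.End C V)ˣ) : Module.End C V)
      map_one' := by
        rw [map_one, deg_one hmul huniq, neg_zero, zpow_zero, Units.val_one, mul_one]
      map_mul' := hρ'mul } with eρ'
  have hρ'apply : ∀ w, ρ' w = r.ρ w * ((u ^ (-deg w) : (Module.End C V)ˣ) : Module.End C V) :=
    fun w => rfl
  have hρ'I : ∀ w ∈ inertia F, ρ' w = r.ρ w := fun w hw => by
    rw [hρ'apply, WeilDeligneRep.deg_eq_zero_of_mem_inertia hw, neg_zero, zpow_zero, Units.val_one,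
      mul_one]
  refine ⟨u, { ρ := ρ'
               isContinuous := ?_
               N := r.N
               isNilpotent_N := r.isNilpotent_N
               conj_N := ?_ }, ⟨rfl, hρ'I, ?_⟩, hunil, huρ, huN, fun w => rfl⟩
  · -- continuity: `ρ' = ρ` on inertia
    obtain ⟨U, hUI, hUo, hU⟩ := r.isContinuous
    exact ⟨U, hUI, hUo, fun x hx => by rw [hρ'I x (hUI hx), hU x hx]⟩
  · -- the Weil–Deligne relation
    intro w
    have hc : Commute ((u ^ (-deg w) : (Module.End C V)ˣ) : Module.End C V) r.N :=
      huN.units_zpow_left (-deg w)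
    change ρ' w * r.N = ((residueFieldCard F : C) ^ deg w) • (r.N * ρ' w)
    rw [hρ'apply, mul_assoc, hc.eq, ← mul_assoc, hq w, smul_mul_assoc, mul_assoc]
  · -- semisimplicity and the nilpotent part
    intro w
    change Module.End.IsSemisimple (ρ' w) ∧ ∃ n' : Module.End C V, IsNilpotent n' ∧
      Commute n' (ρ' w) ∧ r.ρ w = ρ' w + n'
    set d := deg w with ed
    have hρ'w : ρ' w = r.ρ w * ((u ^ (-d) : (Module.End C V)ˣ) : Module.End C V) := rfl
    have cud : ∀ k : ℤ, Commute ((u ^ k : (Module.End C V)ˣ) : Module.End C V) (r.ρ w) :=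
      fun k => (huρ w).units_zpow_left k
    have cρ'ud : Commute (ρ' w) ((u ^ d : (Module.End C V)ˣ) : Module.End C V) := by
      rw [hρ'w]
      exact Commute.mul_left (cud d).symm ((Commute.refl u).zpow_zpow (-d) d).units_val
    refine ⟨?_, ρ' w * (((u ^ d : (Module.End C V)ˣ) : Module.End C V) - 1), ?_, ?_, ?_⟩
    · -- `ρ'(w) ^ m = s ^ (m d) ρ(i')` with `i' ∈ I_F`, a product of commuting semisimples
      have hi' := WeilDeligneRep.zpow_neg_deg_mul_mem_inertia hΦ (w ^ m)
      set i' := Φ ^ (-deg (w ^ m)) * w ^ m with ei'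
      have hwm : w ^ m = Φ ^ (deg (w ^ m)) * i' := by rw [ei', zpow_neg, mul_inv_cancel_left]
      have hdeg : deg (w ^ m) = m * d := WeilDeligneRep.deg_pow w m
      have e1 : (r.ρ.toHomUnits w * u ^ (-d)) ^ m = sU ^ ((m : ℤ) * d) * r.ρ.toHomUnits i' := by
        have c1 : Commute (r.ρ.toHomUnits w) (u ^ (-d)) := Commute.units_of_val (cud (-d)).symm
        have c2 : Commute (u ^ ((m : ℤ) * d)) (r.ρ.toHomUnits i') :=
          Commute.units_of_val ((huρ i').units_zpow_left ((m : ℤ) * d))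
        rw [c1.mul_pow, ← map_pow, hwm, map_mul, map_zpow, hdeg, ← eT, hTsu, csu.mul_zpow,
          ← zpow_natCast (u ^ (-d)) m, ← zpow_mul, show -d * (m : ℤ) = -((m : ℤ) * d) by ring,
          zpow_neg, mul_assoc (sU ^ ((m : ℤ) * d)), c2.eq, ← mul_assoc, mul_inv_cancel_right]
      have hpow : (ρ' w) ^ m =
          ((sU ^ ((m : ℤ) * d) : (Module.End C V)ˣ) : Module.End C V) * r.ρ i' := by
        rw [hρ'w, show r.ρ w * ((u ^ (-d) : (Module.End C V)ˣ) : Module.End C V) =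
          ((r.ρ.toHomUnits w * u ^ (-d) : (Module.End C V)ˣ) : Module.End C V) from rfl,
          ← Units.val_pow_eq_pow_val, e1, Units.val_mul]
        rfl
      have hsUss : (sU : Module.End C V).IsSemisimple := by rw [hsU]; exact hss
      have c3 : Commute (sU ^ m) (r.ρ.toHomUnits i') := by
        rw [hsTu, cTu.inv_right.mul_pow]
        exact Commute.mul_left (hcomm i' hi') ((Commute.units_of_val (huρ i')).inv_left.pow_left m)
      have c4 : Commute (sU ^ ((m : ℤ) * d)) (r.ρ.toHomUnits i') := by
        rw [zpow_mul, zpow_natCast]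
        exact c3.zpow_left d
      have hi'ss : Module.End.IsSemisimple (r.ρ i') := by
        obtain ⟨k, hk, hki⟩ := r.exists_pow_eq_one_of_mem_inertia hi'
        exact FrobSemisimple.isSemisimple_of_pow_eq_one hk
          (by simpa [Units.val_pow_eq_pow_val] using congrArg Units.val hki)
      have hss_pow : Module.End.IsSemisimple ((ρ' w) ^ m) := by
        rw [hpow]
        exact (FrobSemisimple.isSemisimple_units_zpow hsUss _).mul_of_commute c4.units_val hi'ss
      exact FrobSemisimple.isSemisimple_of_isSemisimple_pow ⟨r.ρ.toHomUnits w * u ^ (-d), rfl⟩ hm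
        hss_pow
    · exact (cρ'ud.sub_right (Commute.one_right _)).isNilpotent_mul_left
        (FrobSemisimple.isNilpotent_units_zpow_sub_one hunil d)
    · exact Commute.mul_left (Commute.refl _) (cρ'ud.sub_right (Commute.one_right _)).symm
    · have e : ρ' w + ρ' w * (((u ^ d : (Module.End C V)ˣ) : Module.End C V) - 1) =
          ρ' w * ((u ^ d : (Module.End C V)ˣ) : Module.End C V) := by
        rw [mul_sub, mul_one]
        abel
      rw [e, hρ'w, mul_assoc, ← Units.val_mul, zpow_neg, inv_mul_cancel, Units.val_one, mul_one]

/-- **The inductive core of `Gen(ρ, N) → Gen(ρ^{ss}, N)`.**  In a ring `R` that is a `C`-algebra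
let `u` be a unit, `S : ι → R` a family commuting with `u`, `N` commuting with `u`, `c : ι → C`
scalars, and `T i = S i * u ^ (d i)`.  If the only `g` with `g * T i = c i • (T i * g)` (all `i`)
and `g * N = N * g` is `0`, then the same holds with `S` in place of `T` — for every `g` killed by a
power of `Z = Ad(u) - 1`; the caller supplies nilpotency of `Z`. -/
theorem twisted_zero_of_pow_ad_sub_one
    {C : Type*} [Field C] {R : Type*} [Ring R] [Algebra C R] {ι : Type*}
    (u : Rˣ) (S : ι → R) (N : R) (c : ι → C) (d : ι → ℤ)
    (huS : ∀ i, Commute (u : R) (S i)) (huN : Commute (u : R) N)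
    (hT : ∀ g : R, (∀ i, g * (S i * ((u ^ d i : Rˣ) : R)) = c i • (S i * ((u ^ d i : Rˣ) : R) * g)) →
      g * N = N * g → g = 0) :
    ∀ (k : ℕ) (g : R), (∀ i, g * S i = c i • (S i * g)) → g * N = N * g →
      ((LinearMap.mulLeft C (u : R) * LinearMap.mulRight C ((u⁻¹ : Rˣ) : R) - 1) ^ k) g = 0 →
      g = 0 := by
  set Z : Module.End C R :=
    LinearMap.mulLeft C (u : R) * LinearMap.mulRight C ((u⁻¹ : Rˣ) : R) - 1 with hZ
  have hZapply : ∀ g : R, Z g = (u : R) * (g * ((u⁻¹ : Rˣ) : R)) - g := fun g => by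
    simp only [hZ, LinearMap.sub_apply, Module.End.mul_apply, LinearMap.mulLeft_apply,
      LinearMap.mulRight_apply, Module.End.one_apply]
  have ciS : ∀ i, Commute ((u⁻¹ : Rˣ) : R) (S i) := fun i => (huS i).units_inv_left
  have ciN : Commute ((u⁻¹ : Rˣ) : R) N := huN.units_inv_left
  -- `Z` preserves the twisted-intertwiner conditions for `S`
  have hZS : ∀ g : R, (∀ i, g * S i = c i • (S i * g)) → ∀ i, Z g * S i = c i • (S i * Z g) := by
    intro g hg i
    rw [hZapply, sub_mul, mul_sub, smul_sub, ← hg i]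
    congr 1
    calc (u : R) * (g * ((u⁻¹ : Rˣ) : R)) * S i
        = (u : R) * ((g * S i) * ((u⁻¹ : Rˣ) : R)) := by simp only [mul_assoc, (ciS i).eq]
      _ = (u : R) * ((c i • (S i * g)) * ((u⁻¹ : Rˣ) : R)) := by rw [hg i]
      _ = c i • ((u : R) * S i * (g * ((u⁻¹ : Rˣ) : R))) := by
          simp only [smul_mul_assoc, mul_smul_comm, mul_assoc]
      _ = c i • (S i * ((u : R) * (g * ((u⁻¹ : Rˣ) : R)))) := by rw [(huS i).eq, mul_assoc]
  have hZN : ∀ g : R, g * N = N * g → Z g * N = N * Z g := by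
    intro g hgN
    rw [hZapply, sub_mul, mul_sub, hgN]
    congr 1
    calc (u : R) * (g * ((u⁻¹ : Rˣ) : R)) * N
        = (u : R) * ((g * N) * ((u⁻¹ : Rˣ) : R)) := by simp only [mul_assoc, ciN.eq]
      _ = (u : R) * ((N * g) * ((u⁻¹ : Rˣ) : R)) := by rw [hgN]
      _ = ((u : R) * N) * (g * ((u⁻¹ : Rˣ) : R)) := by simp only [mul_assoc]
      _ = N * ((u : R) * (g * ((u⁻¹ : Rˣ) : R))) := by rw [huN.eq, mul_assoc]
  intro k
  induction k with
  | zero =>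
      intro g _ _ h0
      simpa only [pow_zero, Module.End.one_apply] using h0
  | succ k ih =>
      intro g hg hgN hk
      have hk' : (Z ^ k) (Z g) = 0 := by
        rw [pow_succ, Module.End.mul_apply] at hk
        exact hk
      have hZg : Z g = 0 := ih (Z g) (hZS g hg) (hZN g hgN) hk'
      -- hence `u g u⁻¹ = g`, i.e. `g` commutes with `u`
      have hug : Commute g (u : R) := by
        have e : (u : R) * (g * ((u⁻¹ : Rˣ) : R)) = g := sub_eq_zero.mp (by rw [← hZapply]; exact hZg)
        have e' : (u : R) * g = g * (u : R) := by
          calc (u : R) * g = (u : R) * (g * ((u⁻¹ : Rˣ) : R)) * (u : R) := by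
                rw [mul_assoc, mul_assoc, Units.inv_mul, mul_one]
            _ = g * (u : R) := by rw [e]
        exact e'.symm
      -- so `g` is a twisted intertwiner of `T i = S i * u ^ (d i)`
      refine hT g (fun i => ?_) hgN
      have cgi : Commute g ((u ^ d i : Rˣ) : R) := hug.units_zpow_right (d i)
      rw [← mul_assoc, hg i, smul_mul_assoc, mul_assoc, cgi.eq, ← mul_assoc]

end FrobSSGeneric

open Literature.NumberTheory.GaloisRepresentations
open Literature.NumberTheory.GaloisRepresentations.WeilGroup
open Literature.NumberTheory.GaloisRepresentations.IsNonarchimedeanLocalField in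
/-- `stmt-Langlands-27784` proved by name: genericity passes to and from the
Frobenius-semisimplification. -/
theorem FrobSemisimplificationGeneric_proof :
    Summit.Langlands.Langlands.Theses.MonodromyRankLadder.FrobSemisimplificationGeneric := by
  intro F _ _ _ _ C _ _ V _ _ _ W W' h
  obtain ⟨u, r', hr', hunil, huρ, huN, hρ'⟩ := FrobSSGeneric.exists_unipotent W
  have hWr : W' = r' := h.eq_of_eq hr'
  subst hWr
  have hq0 : (residueFieldCard F : C) ≠ 0 := Nat.cast_ne_zero.mpr (residueFieldCard_ne_zero F)
  have hc0 : ∀ w : WeilGroup F, (residueFieldCard F : C) ^ deg w ≠ 0 := fun w => zpow_ne_zero _ hq0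
  -- `ρ(w) = ρ'(w) u ^ (deg w)`
  have hT : ∀ w, W.ρ w = W'.ρ w * ((u ^ deg w : (Module.End C V)ˣ) : Module.End C V) := fun w => by
    rw [hρ' w, mul_assoc, ← Units.val_mul, ← zpow_add, neg_add_cancel, zpow_zero, Units.val_one,
      mul_one]
  have huS : ∀ w, Commute (u : Module.End C V) (W'.ρ w) := fun w => by
    rw [hρ' w]
    exact Commute.mul_right (huρ w) ((Commute.refl (u : Module.End C V)).units_zpow_right (-deg w))
  have hN' : W'.N = W.N := hr'.1
  constructor
  · -- `Gen(ρ, N) → Gen(ρ^{ss}, N)`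
    intro hgen f hf hfN
    -- `Gen(ρ, N)` in ring form, with `ρ(w)` written as `ρ'(w) u ^ (deg w)`
    have hTgen : ∀ g : Module.End C V,
        (∀ w, g * (W'.ρ w * ((u ^ deg w : (Module.End C V)ˣ) : Module.End C V)) =
          ((residueFieldCard F : C) ^ deg w) •
            (W'.ρ w * ((u ^ deg w : (Module.End C V)ˣ) : Module.End C V) * g)) →
        g * W.N = W.N * g → g = 0 := by
      intro g hg hgN
      refine hgen g (fun w => ?_) (by simpa only [Module.End.mul_eq_comp] using hgN)
      have e := hg w
      rw [← hT w] at e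
      simpa only [Module.End.mul_eq_comp] using e
    -- nilpotency of `Z = Ad(u) - 1 = L_{u-1} R_{u⁻¹} + R_{u⁻¹-1}`
    have hZnil : IsNilpotent (LinearMap.mulLeft C (u : Module.End C V) *
        LinearMap.mulRight C ((u⁻¹ : (Module.End C V)ˣ) : Module.End C V) - 1) := by
      set uE : Module.End C V := (u : Module.End C V) with huE
      set uI : Module.End C V := ((u⁻¹ : (Module.End C V)ˣ) : Module.End C V) with huI
      have hx : IsNilpotent (LinearMap.mulLeft C (uE - 1)) := by
        obtain ⟨k, hk⟩ := hunil
        exact ⟨k, by rw [LinearMap.pow_mulLeft, hk, LinearMap.mulLeft_zero_eq_zero]⟩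
      have hy : IsNilpotent (LinearMap.mulRight C (uI - 1)) := by
        have h1 : IsNilpotent (uI - 1) := by
          have := FrobSemisimple.isNilpotent_units_zpow_sub_one hunil (-1)
          rwa [zpow_neg_one] at this
        obtain ⟨k, hk⟩ := h1
        exact ⟨k, by rw [LinearMap.pow_mulRight, hk, LinearMap.mulRight_zero_eq_zero]⟩
      have hA : IsNilpotent (LinearMap.mulLeft C (uE - 1) * LinearMap.mulRight C uI) :=
        (LinearMap.commute_mulLeft_right (uE - 1) uI).isNilpotent_mul_right hx
      have hRR : Commute (LinearMap.mulRight C uI) (LinearMap.mulRight C (uI - 1)) := by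
        change LinearMap.mulRight C uI * LinearMap.mulRight C (uI - 1) =
          LinearMap.mulRight C (uI - 1) * LinearMap.mulRight C uI
        refine LinearMap.ext fun g => ?_
        simp only [Module.End.mul_apply, LinearMap.mulRight_apply]
        noncomm_ring
      have hcomm : Commute (LinearMap.mulLeft C (uE - 1) * LinearMap.mulRight C uI)
          (LinearMap.mulRight C (uI - 1)) :=
        Commute.mul_left (LinearMap.commute_mulLeft_right (uE - 1) (uI - 1)) hRR
      have hZeq : LinearMap.mulLeft C uE * LinearMap.mulRight C uI - 1 =
          LinearMap.mulLeft C (uE - 1) * LinearMap.mulRight C uI + LinearMap.mulRight C (uI - 1) := by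
        refine LinearMap.ext fun g => ?_
        simp only [LinearMap.sub_apply, LinearMap.add_apply, Module.End.mul_apply,
          LinearMap.mulLeft_apply, LinearMap.mulRight_apply, Module.End.one_apply]
        noncomm_ring
      rw [hZeq]
      exact hcomm.isNilpotent_add hA hy
    obtain ⟨K, hK⟩ := hZnil
    have hf1 : ∀ w, f * W'.ρ w = ((residueFieldCard F : C) ^ deg w) • (W'.ρ w * f) := fun w => by
      simpa only [Module.End.mul_eq_comp] using hf w
    have hf2 : f * W.N = W.N * f := by
      rw [← hN']
      simpa only [Module.End.mul_eq_comp] using hfN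
    exact FrobSSGeneric.twisted_zero_of_pow_ad_sub_one u (fun w => W'.ρ w) W.N
      (fun w => (residueFieldCard F : C) ^ deg w) (fun w => deg w) huS huN hTgen K f hf1 hf2
      (by rw [hK]; rfl)
  · -- `Gen(ρ^{ss}, N) → Gen(ρ, N)`: Jordan–Chevalley
    intro hgen' f hf hfN
    refine hgen' f (fun w => ?_) (by rw [hN']; exact hfN)
    obtain ⟨hs, n, hn, hnc, he⟩ := hr'.2.2 w
    have e1 : f * W.ρ w = ((residueFieldCard F : C) ^ deg w) • (W.ρ w * f) := by
      simpa only [Module.End.mul_eq_comp] using hf w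
    have e2 : W.ρ w * f = ((residueFieldCard F : C) ^ deg w)⁻¹ • (f * W.ρ w) := by
      rw [e1, smul_smul, inv_mul_cancel₀ (hc0 w), one_smul]
    have e3 : W'.ρ w * f = ((residueFieldCard F : C) ^ deg w)⁻¹ • (f * W'.ρ w) :=
      FrobSemisimple.mul_eq_smul_mul_of_jordanChevalley (by rw [he, add_comm]) hs hn hnc.symm e2
    have e4 : f * W'.ρ w = ((residueFieldCard F : C) ^ deg w) • (W'.ρ w * f) := by
      rw [e3, smul_smul, mul_inv_cancel₀ (hc0 w), one_smul]
    simpa only [Module.End.mul_eq_comp] using e4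
end Summit.Langlands.Langlands.Theorems
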